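import Literature.AlgebraicGeometry.Motives.ThickeningTower
import HarnessLib

/-!
# Čech trivialisations on the infinitesimal neighbourhoods of a fibre, in the flat model

Setting (Görtz–Wedhorn II, Lemma 24.72, proof, Step (I)): `T` a `K`-scheme, `x` a point of an
affine open `B ⊆ T` (`Λ = Γ(B, 𝒪_T)`), `P` a `K`-scheme with a morphism `g : P ×_K T → X` to an
integral scheme `X` carrying a Cartier divisor `D = (U_i, f_i)` (the cases of interest are
`X = (X₀ × Y₀) ×_K T`, `g = id` and the slices `g = {x₀} × Y₀ × T`, `X₀ × {y₀} × T`), and a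
`Λ`-algebra `R` (`= 𝒪_{T,x}/𝔪^{n+1}` or `κ(x)`) with `ι_R : P ×_K Spec R → P ×_K T`
(`Motives/ThickeningModel`). A **tower cover** (`TowerCover`) is a family of opens `V_a ⊆ X`
inside charts `U_{c(a)}` whose preimages `W_a = g⁻¹V_a ⊆ pr_T⁻¹B` are affine and cover the fibre
over `x`; by `Motives/ThickeningModel` the rings of functions on `ι_R⁻¹W_a`, `ι_R⁻¹(W_a ∩ W_b)`,
… are the flat models `C_a ⊗_Λ R`, `C_ab ⊗_Λ R`, … (`C_S = Γ(W_S, 𝒪_{P × T})`).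

This file moves the Čech trivialisations of `(ι_R ≫ g)^*𝒪_X(D)` on the opens `ι_R⁻¹W_a`
(`ChartedCover.CechTriv`, `Motives/CartierDivisorCechTrivialization`) into the model:

* `TowerCover.cocycle 𝒲 a b ∈ C_ab` — the function `g^*(f_{c(a)}/f_{c(b)})` on `W_a ∩ W_b`, with
  the cocycle identity in `C_abc`;
* `TowerCover.ModelTriv 𝒲 R` — units `s_a ∈ C_a ⊗_Λ R` with
  `s_a|_{ab} = (g_ab ⊗ 1) · s_b|_{ab}` (`|_{ab}` = `res ⊗ id`);
* `ModelTriv.toCechTriv` / `ModelTriv.ofCechTriv` — the dictionary with `CechTriv` along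
  `ι_R ≫ g` through the model isomorphisms `Γ(ι_R⁻¹W_S) ≅ C_S ⊗_Λ R` (`OpenOver.modelEquiv`) and
  their naturality under restriction (`res_modelHom`);
* `ModelTriv.mapLevel` (change of `R` along `ψ : R → R'`, i.e. restriction to a smaller
  infinitesimal neighbourhood) and `ofCechTriv_restrict_transition` (it matches
  `CechTriv.restrict` along the transition map, `transitionMap_modelHom`);
* `TowerCover.slice` (the tower cover `(q × T)⁻¹W_a` of `P'` for a `K`-morphism `q : P' → P` with
  `q × T` affine), `ModelTriv.mapSlice` (`(q × T)^* ⊗ id`) and `ofCechTriv_restrict_slice` (it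
  matches `CechTriv.restrict` along `q × Spec R`, `sliceMap_modelHom`).

Everything is proved; this is bookkeeping for `Motives/CubeStepIObstruction`.

## References

* U. Görtz, T. Wedhorn, *Algebraic Geometry II: Cohomology of Schemes*, Springer Spektrum (2023),
  doi:10.1007/978-3-658-43031-3: Lemma 24.72, proof, Step (I), p. 548. [GortzWedhorn2023]
* U. Görtz, T. Wedhorn, *Algebraic Geometry I: Schemes*, 2nd ed. (2020): (11.6), Prop. 11.15,
  pp. 365–369 (Čech description of line bundles). [GortzWedhorn2020]
-/

universe u

open CategoryTheory CategoryTheory.Limits AlgebraicGeometry MonoidalCategory TopologicalSpace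
open CartesianMonoidalCategory TensorProduct Opposite

noncomputable section

namespace Literature.AlgebraicGeometry.Motives

variable {K : Type u} [Field K] {T : SchemeOver K} {B : T.left.Opens}

/-! ### Algebra: compositions of `f ⊗ id` and `id ⊗ ψ` -/

section TensorMaps

variable {Λ : Type u} [CommRing Λ] {A₁ A₂ A₃ R R' : Type u} [CommRing A₁] [CommRing A₂] [CommRing A₃]
  [CommRing R] [CommRing R'] [Algebra Λ A₁] [Algebra Λ A₂] [Algebra Λ A₃] [Algebra Λ R]
  [Algebra Λ R']

/-- `(f' ⊗ id) ∘ (f ⊗ id) = (f' ∘ f) ⊗ id`, pointwise. [folklore] -/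
theorem map_id_map_id (f' : A₂ →ₐ[Λ] A₃) (f : A₁ →ₐ[Λ] A₂) (z : A₁ ⊗[Λ] R) :
    Algebra.TensorProduct.map f' (AlgHom.id Λ R) (Algebra.TensorProduct.map f (AlgHom.id Λ R) z) =
      Algebra.TensorProduct.map (f'.comp f) (AlgHom.id Λ R) z := by
  induction z using TensorProduct.induction_on with
  | zero => simp only [map_zero]
  | add z z' hz hz' => simp only [map_add, hz, hz']
  | tmul a r => rfl

/-- `(f ⊗ id) ∘ (id ⊗ ψ) = (id ⊗ ψ) ∘ (f ⊗ id)` (both are `f ⊗ ψ`), pointwise. [folklore] -/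
theorem map_id_map_right (f : A₁ →ₐ[Λ] A₂) (ψ : R →ₐ[Λ] R') (z : A₁ ⊗[Λ] R) :
    Algebra.TensorProduct.map f (AlgHom.id Λ R') (Algebra.TensorProduct.map (AlgHom.id Λ A₁) ψ z) =
      Algebra.TensorProduct.map (AlgHom.id Λ A₂) ψ
        (Algebra.TensorProduct.map f (AlgHom.id Λ R) z) := by
  induction z using TensorProduct.induction_on with
  | zero => simp only [map_zero]
  | add z z' hz hz' => simp only [map_add, hz, hz']
  | tmul a r => rfl

/-- Two `Λ`-algebra maps that agree give the same `f ⊗ id`. [folklore] -/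
theorem map_congr_left {f f' : A₁ →ₐ[Λ] A₂} (h : ∀ a, f a = f' a) (z : A₁ ⊗[Λ] R) :
    Algebra.TensorProduct.map f (AlgHom.id Λ R) z = Algebra.TensorProduct.map f' (AlgHom.id Λ R) z := by
  rw [show f = f' from AlgHom.ext h]

end TensorMaps

/-! ### Tower covers -/

/-- **A tower cover**: for a morphism `g : P ×_K T → X` to an integral scheme with Cartier divisor
`D`, an affine open `B ⊆ T` and a point `x ∈ B`, a family of opens `V_a ⊆ U_{c(a)}` of `X` whose
preimages `W_a = g⁻¹V_a` are affine, lie over `B` and cover the fibre of `P ×_K T → T` over `x` —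
the refinement of the chart covering of `D` on which the Čech computations of Step (I) of
Görtz–Wedhorn II, Lemma 24.72 are carried out (`g = id` for the total space, `g` = a slice
`{x₀} × Y₀ × T → X₀ × Y₀ × T` for the comparison maps (24.14.1)). [folklore] -/
structure TowerCover {T : SchemeOver K} {B : T.left.Opens} (x : B) {X : Scheme.{u}} [IsIntegral X]
    (D : CartierDivisor X) (P : SchemeOver K) (g : (P ⊗ T).left ⟶ X) where
  /-- The index type. -/
  κ : Type u
  /-- The opens `V_a ⊆ X`. -/
  V : κ → X.Opens
  /-- A chart of `D` containing `V_a`. -/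
  chart : κ → D.ι
  /-- `V_a ⊆ U_{c(a)}`. -/
  V_le : ∀ a, V a ≤ D.U (chart a)
  /-- `g⁻¹V_a` lies over `B`. -/
  preimage_le : ∀ a, g ⁻¹ᵁ V a ≤ (snd P T).left ⁻¹ᵁ B
  /-- `g⁻¹V_a` is affine. -/
  isAffineOpen : ∀ a, IsAffineOpen (g ⁻¹ᵁ V a)
  /-- The `g⁻¹V_a` cover the fibre over `x`. -/
  covers : ∀ y : (P ⊗ T).left, (snd P T).left y = x.1 → ∃ a, y ∈ g ⁻¹ᵁ V a

namespace TowerCover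

variable {x : B} {X : Scheme.{u}} [IsIntegral X] {D : CartierDivisor X} {P : SchemeOver K}
  {g : (P ⊗ T).left ⟶ X} (𝒲 : TowerCover x D P g)

/-- The underlying charted family of opens of `X` (`Motives/CartierDivisorCechTrivialization`).
[folklore] -/
def toChartedCover : D.ChartedCover := ⟨𝒲.κ, 𝒲.V, 𝒲.chart, 𝒲.V_le⟩

/-- The opens of the underlying charted family. [folklore] -/
@[simp] theorem toChartedCover_V (a : 𝒲.κ) : 𝒲.toChartedCover.V a = 𝒲.V a := rfl

/-- The charts of the underlying charted family. [folklore] -/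
@[simp] theorem toChartedCover_chart (a : 𝒲.κ) : 𝒲.toChartedCover.chart a = 𝒲.chart a := rfl

/-- **`W_a = g⁻¹V_a`** as an open of `P ×_K T` over `B`. [folklore] -/
abbrev W (a : 𝒲.κ) : OpenOver (snd P T).left B := ⟨g ⁻¹ᵁ 𝒲.V a, 𝒲.preimage_le a⟩

/-- `W_ab = W_a ∩ W_b`. [folklore] -/
abbrev W₂ (a b : 𝒲.κ) : OpenOver (snd P T).left B := (𝒲.W a).inf (𝒲.W b)

/-- `W_abd = W_a ∩ W_b ∩ W_d`. [folklore] -/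
abbrev W₃ (a b d : 𝒲.κ) : OpenOver (snd P T).left B := ((𝒲.W a).inf (𝒲.W b)).inf (𝒲.W d)

/-- The underlying open of `W_a`. [folklore] -/
@[simp] theorem W_U (a : 𝒲.κ) : (𝒲.W a).U = g ⁻¹ᵁ 𝒲.V a := rfl

/-- `W_ab ⊆ g⁻¹(U_{c(a)} ∩ U_{c(b)})`. [folklore] -/
theorem W₂_le (a b : 𝒲.κ) : (𝒲.W₂ a b).U ≤ g ⁻¹ᵁ (D.U (𝒲.chart a) ⊓ D.U (𝒲.chart b)) :=
  fun _ hy => ⟨𝒲.V_le a hy.1, 𝒲.V_le b hy.2⟩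

/-- `W_ab` is affine (`pr_T` separated). [folklore] -/
theorem isAffineOpen_W₂ (hB : IsAffineOpen B) [IsSeparated P.hom] (a b : 𝒲.κ) :
    IsAffineOpen (𝒲.W₂ a b).U :=
  OpenOver.isAffineOpen_inf hB _ _ (𝒲.isAffineOpen a) (𝒲.isAffineOpen b)

/-- `W_abd` is affine. [folklore] -/
theorem isAffineOpen_W₃ (hB : IsAffineOpen B) [IsSeparated P.hom] (a b d : 𝒲.κ) :
    IsAffineOpen (𝒲.W₃ a b d).U :=
  OpenOver.isAffineOpen_inf hB _ _ (𝒲.isAffineOpen_W₂ hB a b) (𝒲.isAffineOpen d)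

/-! #### The rings `C_S = Γ(W_S)` and the restriction maps -/

/-- `C_a = Γ(W_a, 𝒪_{P × T})`, a `Γ(B)`-algebra. [folklore] -/
abbrev C (a : 𝒲.κ) : Type u := (𝒲.W a).Sec

/-- `C_ab = Γ(W_a ∩ W_b, 𝒪_{P × T})`. [folklore] -/
abbrev C₂ (a b : 𝒲.κ) : Type u := (𝒲.W₂ a b).Sec

/-- `C_abd = Γ(W_a ∩ W_b ∩ W_d, 𝒪_{P × T})`. [folklore] -/
abbrev C₃ (a b d : 𝒲.κ) : Type u := (𝒲.W₃ a b d).Sec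

/-- Restriction `C_a → C_ab`. [folklore] -/
abbrev rl (a b : 𝒲.κ) : 𝒲.C a →ₐ[Γ(T.left, B)] 𝒲.C₂ a b := OpenOver.res inf_le_left

/-- Restriction `C_b → C_ab`. [folklore] -/
abbrev rr (a b : 𝒲.κ) : 𝒲.C b →ₐ[Γ(T.left, B)] 𝒲.C₂ a b := OpenOver.res inf_le_right

/-- Restriction `C_ab → C_abd`. [folklore] -/
abbrev r₁₂ (a b d : 𝒲.κ) : 𝒲.C₂ a b →ₐ[Γ(T.left, B)] 𝒲.C₃ a b d := OpenOver.res inf_le_left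

/-- Restriction `C_bd → C_abd`. [folklore] -/
abbrev r₂₃ (a b d : 𝒲.κ) : 𝒲.C₂ b d →ₐ[Γ(T.left, B)] 𝒲.C₃ a b d :=
  OpenOver.res (le_inf (inf_le_left.trans inf_le_right) inf_le_right)

/-- Restriction `C_ad → C_abd`. [folklore] -/
abbrev r₁₃ (a b d : 𝒲.κ) : 𝒲.C₂ a d →ₐ[Γ(T.left, B)] 𝒲.C₃ a b d :=
  OpenOver.res (le_inf (inf_le_left.trans inf_le_left) inf_le_right)

/-- Restriction `C_a → C_abd`. [folklore] -/
abbrev r₁ (a b d : 𝒲.κ) : 𝒲.C a →ₐ[Γ(T.left, B)] 𝒲.C₃ a b d :=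
  OpenOver.res (inf_le_left.trans inf_le_left)

/-- `f ⊗ id_R` for a `Γ(B)`-algebra map `f`. [folklore] -/
abbrev ten {A₁ A₂ : Type u} [CommRing A₁] [CommRing A₂] [Algebra Γ(T.left, B) A₁]
    [Algebra Γ(T.left, B) A₂] (R : Type u) [CommRing R] [Algebra Γ(T.left, B) R]
    (f : A₁ →ₐ[Γ(T.left, B)] A₂) : A₁ ⊗[Γ(T.left, B)] R →ₐ[Γ(T.left, B)] A₂ ⊗[Γ(T.left, B)] R :=
  Algebra.TensorProduct.map f (AlgHom.id _ R)

/-! #### The cocycle `g^*(f_{c(a)}/f_{c(b)})` on `W_ab` -/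

/-- **The cocycle function `g_ab = g^*(f_{c(a)}/f_{c(b)}) ∈ C_ab`** (`CartierDivisor.pullTrans`).
[folklore] -/
def cocycle (a b : 𝒲.κ) : 𝒲.C₂ a b := D.pullTrans g (𝒲.chart a) (𝒲.chart b) _ (𝒲.W₂_le a b)

/-- `g_ab` is a unit. [folklore] -/
theorem isUnit_cocycle (a b : 𝒲.κ) : IsUnit (𝒲.cocycle a b) := D.isUnit_pullTrans _ _ _ _ _

/-- **The cocycle identity** `g_ab|·g_bd| = g_ad|` in `C_abd`. [folklore] -/
theorem cocycle_mul_cocycle (a b d : 𝒲.κ) :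
    𝒲.r₁₂ a b d (𝒲.cocycle a b) * 𝒲.r₂₃ a b d (𝒲.cocycle b d) = 𝒲.r₁₃ a b d (𝒲.cocycle a d) := by
  rw [OpenOver.res_apply, OpenOver.res_apply, OpenOver.res_apply, cocycle, cocycle, cocycle,
    D.map_pullTrans, D.map_pullTrans, D.map_pullTrans]
  exact D.pullTrans_mul_pullTrans g _ _ _ (𝒲.W₃ a b d).U (fun _ hy => 𝒲.V_le a hy.1.1)
    (fun _ hy => 𝒲.V_le b hy.1.2) (fun _ hy => 𝒲.V_le d hy.2)

/-- `g_ab|·g_ba| = 1` in `C_aba` (hence `g_ab` and `g_ba|` are mutually inverse). [folklore] -/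
theorem cocycle_mul_cocycle_symm (a b : 𝒲.κ) :
    𝒲.r₁₂ a b a (𝒲.cocycle a b) * 𝒲.r₂₃ a b a (𝒲.cocycle b a) = 1 := by
  rw [cocycle_mul_cocycle, OpenOver.res_apply, cocycle, D.map_pullTrans, D.pullTrans_self]
  rfl

/-! ### Čech trivialisations in the model -/

variable (R : Type u) [CommRing R] [Algebra Γ(T.left, B) R]

/-- **A Čech trivialisation of `(ι_R ≫ g)^*𝒪_X(D)` in the flat model**: units
`s_a ∈ C_a ⊗_Λ R = Γ(ι_R⁻¹W_a)` with `s_a|_{ab} = (g_ab ⊗ 1) · s_b|_{ab}` in `C_ab ⊗_Λ R`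
(Görtz–Wedhorn I, (11.6): a `0`-cochain trivialising the pulled-back cocycle). [folklore] -/
structure ModelTriv where
  /-- The coordinates `s_a ∈ C_a ⊗ R`. -/
  s : ∀ a : 𝒲.κ, 𝒲.C a ⊗[Γ(T.left, B)] R
  /-- They are units. -/
  isUnit : ∀ a, IsUnit (s a)
  /-- `s_a| = (g_ab ⊗ 1) s_b|` in `C_ab ⊗ R`. -/
  rel : ∀ a b, ten R (𝒲.rl a b) (s a) = (𝒲.cocycle a b ⊗ₜ 1) * ten R (𝒲.rr a b) (s b)

namespace ModelTriv

variable {𝒲 R}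

/-- Two model trivialisations with the same coordinates are equal. [folklore] -/
@[ext] theorem ext {t t' : 𝒲.ModelTriv R} (h : ∀ a, t.s a = t'.s a) : t = t' := by
  cases t; cases t'; congr; exact funext h

/-- **Change of level**: `(id ⊗ ψ)(s_a)` is a model trivialisation over `R'` for a `Γ(B)`-algebra
map `ψ : R → R'` (restriction to a smaller infinitesimal neighbourhood). [folklore] -/
def mapLevel {R' : Type u} [CommRing R'] [Algebra Γ(T.left, B) R'] (ψ : R →ₐ[Γ(T.left, B)] R')
    (t : 𝒲.ModelTriv R) : 𝒲.ModelTriv R' where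
  s a := Algebra.TensorProduct.map (AlgHom.id Γ(T.left, B) _) ψ (t.s a)
  isUnit a := (t.isUnit a).map _
  rel a b := by
    have h := congrArg (Algebra.TensorProduct.map (AlgHom.id Γ(T.left, B) _) ψ) (t.rel a b)
    rw [map_mul, Algebra.TensorProduct.map_tmul, AlgHom.id_apply, map_one] at h
    rw [ten, ten, map_id_map_right, map_id_map_right, h]

/-- The coordinates after a change of level. [folklore] -/
@[simp] theorem mapLevel_s {R' : Type u} [CommRing R'] [Algebra Γ(T.left, B) R']
    (ψ : R →ₐ[Γ(T.left, B)] R') (t : 𝒲.ModelTriv R) (a : 𝒲.κ) :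
    (t.mapLevel ψ).s a = Algebra.TensorProduct.map (AlgHom.id Γ(T.left, B) _) ψ (t.s a) := rfl

end ModelTriv

/-! ### The dictionary with Čech trivialisations on `ι_R⁻¹W_a ⊆ P × Spec R` -/

section Dictionary

variable (hB : IsAffineOpen B)

/-- The structure morphism `ι_R ≫ g : P × Spec R → X` along which `D` is pulled back (an
abbreviation; it depends on the cover only through `g`). [folklore] -/
abbrev strMap (_𝒲 : TowerCover x D P g) (R : Type u) [CommRing R] [Algebra Γ(T.left, B) R]
    (hB : IsAffineOpen B) : (P ⊗ modelPt T hB R).left ⟶ X :=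
  (P ◁ modelPtι T hB R).left ≫ g

/-- `(ι_R ≫ g)⁻¹V_a = ι_R⁻¹W_a` is the thickening of `W_a` (definitional). [folklore] -/
theorem preimage_strMap (a : 𝒲.κ) :
    𝒲.strMap R hB ⁻¹ᵁ 𝒲.V a = ((𝒲.W a).thick hB R).U := rfl

/-- The pulled-back cocycle `(ι_R ≫ g)^*(f_{c(a)}/f_{c(b)})` on `ι_R⁻¹W_ab` is the model element
`g_ab ⊗ 1`. [folklore] -/
theorem trans_eq_modelHom (a b : 𝒲.κ) :
    𝒲.toChartedCover.trans (𝒲.strMap R hB) a b =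
      (𝒲.W₂ a b).modelHom hB R (𝒲.cocycle a b ⊗ₜ 1) := by
  rw [OpenOver.modelHom_tmul, map_one, mul_one]
  change D.pullTrans _ _ _ _ _ = (P ◁ modelPtι T hB R).left.appLE _ _ _ (D.pullTrans g _ _ _ _)
  rw [D.appLE_pullTrans]
  rfl

variable {𝒲 R hB}

/-- **From the model to the scheme**: a model trivialisation gives a Čech trivialisation of
`(ι_R ≫ g)^*𝒪_X(D)` on the opens `ι_R⁻¹W_a`, through the model isomorphisms
`C_S ⊗_Λ R ≅ Γ(ι_R⁻¹W_S)` (`OpenOver.modelEquiv`). [folklore] -/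
def ModelTriv.toCechTriv (t : 𝒲.ModelTriv R) : 𝒲.toChartedCover.CechTriv (𝒲.strMap R hB) where
  s a := (𝒲.W a).modelEquiv hB R (𝒲.isAffineOpen a) (t.s a)
  isUnit a := (t.isUnit a).map _
  cocycle a b := by
    have key : OpenOver.res (OpenOver.thick_mono hB R (V := 𝒲.W a) (W := 𝒲.W₂ a b) inf_le_left)
        ((𝒲.W a).modelHom hB R (t.s a)) =
      (𝒲.W₂ a b).modelHom hB R (𝒲.cocycle a b ⊗ₜ 1) *
        OpenOver.res (OpenOver.thick_mono hB R (V := 𝒲.W b) (W := 𝒲.W₂ a b) inf_le_right)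
          ((𝒲.W b).modelHom hB R (t.s b)) := by
      rw [OpenOver.res_modelHom hB R (V := 𝒲.W a) (W := 𝒲.W₂ a b) inf_le_left,
        OpenOver.res_modelHom hB R (V := 𝒲.W b) (W := 𝒲.W₂ a b) inf_le_right, ← map_mul]
      exact congrArg _ (t.rel a b)
    refine key.trans ?_
    rw [trans_eq_modelHom]
    rfl

/-- The coordinates of `toCechTriv`. [folklore] -/
@[simp] theorem ModelTriv.toCechTriv_s (t : 𝒲.ModelTriv R) (a : 𝒲.κ) :
    (t.toCechTriv (hB := hB)).s a = (𝒲.W a).modelEquiv hB R (𝒲.isAffineOpen a) (t.s a) := rfl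

/-! #### The transition maps -/

section Transition

variable {R' : Type u} [CommRing R'] [Algebra Γ(T.left, B) R'] (ψ : R →ₐ[Γ(T.left, B)] R')

/-- `(P × Spec R' → P × Spec R) ≫ (ι_R ≫ g) = ι_{R'} ≫ g`. [folklore] -/
theorem transition_comp_strMap (𝒲 : TowerCover x D P g) :
    (P ◁ OpenOver.modelTransition hB ψ).left ≫ 𝒲.strMap R hB = 𝒲.strMap R' hB := by
  change (P ◁ OpenOver.modelTransition hB ψ).left ≫ ((P ◁ modelPtι T hB R).left ≫ g) =
    (P ◁ modelPtι T hB R').left ≫ g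
  rw [← Category.assoc, OpenOver.whiskerLeft_modelTransition_comp_left]

end Transition

/-! #### Slices -/

section Slice

variable {P' : SchemeOver K} (q : P' ⟶ P) [IsAffineHom (q ▷ T).left]

/-- **The sliced tower cover** `(q × T)⁻¹W_a` of `P'`, for a `K`-morphism `q : P' → P` with `q × T`
affine (e.g. a closed immersion), relative to `(q × T) ≫ g`. [folklore] -/
abbrev slice (𝒲 : TowerCover x D P g) : TowerCover x D P' ((q ▷ T).left ≫ g) where
  κ := 𝒲.κ
  V := 𝒲.V
  chart := 𝒲.chart
  V_le := 𝒲.V_le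
  preimage_le a := by
    rw [Scheme.Hom.comp_preimage, ← OpenOver.whiskerRight_snd_left q T, Scheme.Hom.comp_preimage]
    exact Scheme.Hom.preimage_mono _ (𝒲.preimage_le a)
  isAffineOpen a := by
    rw [Scheme.Hom.comp_preimage]
    exact (𝒲.isAffineOpen a).preimage _
  covers y hy := by
    have hy' : (snd P T).left ((q ▷ T).left y) = x.1 := by
      rw [← Scheme.Hom.comp_apply, OpenOver.whiskerRight_snd_left]; exact hy
    obtain ⟨a, ha⟩ := 𝒲.covers _ hy'
    exact ⟨a, ha⟩

/-- The opens of the sliced cover are the preimages `(q × T)⁻¹W_a` (definitional). [folklore] -/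
theorem slice_W (𝒲 : TowerCover x D P g) (a : 𝒲.κ) :
    (𝒲.slice q).W a = (𝒲.W a).slicePreimage q := rfl

/-- The pullback `(q × T)^* : C_a → C'_a` on the rings of the covers. [folklore] -/
abbrev sliceComap (𝒲 : TowerCover x D P g) (a : 𝒲.κ) : 𝒲.C a →ₐ[Γ(T.left, B)] (𝒲.slice q).C a :=
  (𝒲.W a).comap (q ▷ T).left (OpenOver.whiskerRight_snd_left q T) ((𝒲.W a).slicePreimage q) le_rfl

/-- The pullback `(q × T)^* : C_ab → C'_ab`. [folklore] -/
abbrev sliceComap₂ (𝒲 : TowerCover x D P g) (a b : 𝒲.κ) :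
    𝒲.C₂ a b →ₐ[Γ(T.left, B)] (𝒲.slice q).C₂ a b :=
  (𝒲.W₂ a b).comap (q ▷ T).left (OpenOver.whiskerRight_snd_left q T)
    ((𝒲.W₂ a b).slicePreimage q) le_rfl

/-- The sliced cocycle is the pullback of the cocycle: `g'_ab = (q × T)^* g_ab`. [folklore] -/
theorem slice_cocycle (𝒲 : TowerCover x D P g) (a b : 𝒲.κ) :
    (𝒲.slice q).cocycle a b = 𝒲.sliceComap₂ q a b (𝒲.cocycle a b) := by
  change _ = (q ▷ T).left.appLE _ _ _ (D.pullTrans g _ _ _ _)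
  rw [D.appLE_pullTrans]
  rfl

/-- `(q × T)^*` commutes with the restrictions `C_a → C_ab`. [folklore] -/
theorem sliceComap₂_rl (𝒲 : TowerCover x D P g) (a b : 𝒲.κ) (c : 𝒲.C a) :
    𝒲.sliceComap₂ q a b (𝒲.rl a b c) = (𝒲.slice q).rl a b (𝒲.sliceComap q a c) :=
  (OpenOver.comap_res _ _ _ _ _ _).trans (OpenOver.res_comap _ _ _ _ _ _).symm

/-- `(q × T)^*` commutes with the restrictions `C_b → C_ab`. [folklore] -/
theorem sliceComap₂_rr (𝒲 : TowerCover x D P g) (a b : 𝒲.κ) (c : 𝒲.C b) :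
    𝒲.sliceComap₂ q a b (𝒲.rr a b c) = (𝒲.slice q).rr a b (𝒲.sliceComap q b c) :=
  (OpenOver.comap_res _ _ _ _ _ _).trans (OpenOver.res_comap _ _ _ _ _ _).symm

/-- **Slicing a model trivialisation**: `((q × T)^* ⊗ id)(s_a)` is a model trivialisation for the
sliced cover. [folklore] -/
def ModelTriv.mapSlice (t : 𝒲.ModelTriv R) : (𝒲.slice q).ModelTriv R where
  s a := Algebra.TensorProduct.map (𝒲.sliceComap q a) (AlgHom.id _ R) (t.s a)
  isUnit a := (t.isUnit a).map _
  rel a b := by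
    have h := congrArg (Algebra.TensorProduct.map (𝒲.sliceComap₂ q a b) (AlgHom.id _ R)) (t.rel a b)
    rw [map_mul, Algebra.TensorProduct.map_tmul, AlgHom.id_apply, ← slice_cocycle] at h
    have e1 : ten R ((𝒲.slice q).rl a b) (Algebra.TensorProduct.map (𝒲.sliceComap q a)
        (AlgHom.id _ R) (t.s a)) =
        Algebra.TensorProduct.map (𝒲.sliceComap₂ q a b) (AlgHom.id _ R) (ten R (𝒲.rl a b) (t.s a)) := by
      rw [ten, ten, map_id_map_id, map_id_map_id]
      exact map_congr_left (fun c => ((𝒲.sliceComap₂_rl q a b c).symm)) _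
    have e2 : ten R ((𝒲.slice q).rr a b) (Algebra.TensorProduct.map (𝒲.sliceComap q b)
        (AlgHom.id _ R) (t.s b)) =
        Algebra.TensorProduct.map (𝒲.sliceComap₂ q a b) (AlgHom.id _ R) (ten R (𝒲.rr a b) (t.s b)) := by
      rw [ten, ten, map_id_map_id, map_id_map_id]
      exact map_congr_left (fun c => ((𝒲.sliceComap₂_rr q a b c).symm)) _
    rw [e1, e2, h]

/-- The coordinates of a sliced model trivialisation. [folklore] -/
@[simp] theorem ModelTriv.mapSlice_s (t : 𝒲.ModelTriv R) (a : 𝒲.κ) :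
    (t.mapSlice q).s a = Algebra.TensorProduct.map (𝒲.sliceComap q a) (AlgHom.id _ R) (t.s a) := rfl

/-- `(q × Spec R) ≫ (ι_R ≫ g) = ι'_R ≫ ((q × T) ≫ g)`. [folklore] -/
theorem slice_comp_strMap (𝒲 : TowerCover x D P g) :
    (q ▷ modelPt T hB R).left ≫ 𝒲.strMap R hB = (𝒲.slice q).strMap R hB := by
  change (q ▷ modelPt T hB R).left ≫ ((P ◁ modelPtι T hB R).left ≫ g) =
    (P' ◁ modelPtι T hB R).left ≫ ((q ▷ T).left ≫ g)
  rw [← Category.assoc, OpenOver.whiskerRight_whiskerLeft_left, Category.assoc]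

end Slice

/-! #### From the scheme to the model (over a separated `P`) -/

variable [IsSeparated P.hom]

/-- **From the scheme to the model**: a Čech trivialisation of `(ι_R ≫ g)^*𝒪_X(D)` on the
`ι_R⁻¹W_a` gives a model trivialisation (`P → Spec K` separated, so that the `W_a ∩ W_b` are
affine). [folklore] -/
def ModelTriv.ofCechTriv (t : 𝒲.toChartedCover.CechTriv (𝒲.strMap R hB)) : 𝒲.ModelTriv R where
  s a := ((𝒲.W a).modelEquiv hB R (𝒲.isAffineOpen a)).symm (t.s a)
  isUnit a := (t.isUnit a).map _
  rel a b := by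
    apply ((𝒲.W₂ a b).modelHom_bijective hB R (𝒲.isAffineOpen_W₂ hB a b)).1
    have ea : (𝒲.W a).modelHom hB R (((𝒲.W a).modelEquiv hB R (𝒲.isAffineOpen a)).symm (t.s a)) =
        t.s a :=
      ((𝒲.W a).modelEquiv hB R (𝒲.isAffineOpen a)).apply_symm_apply (t.s a)
    have eb : (𝒲.W b).modelHom hB R (((𝒲.W b).modelEquiv hB R (𝒲.isAffineOpen b)).symm (t.s b)) =
        t.s b :=
      ((𝒲.W b).modelEquiv hB R (𝒲.isAffineOpen b)).apply_symm_apply (t.s b)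
    have ha := OpenOver.res_modelHom hB R (V := 𝒲.W a) (W := 𝒲.W₂ a b) inf_le_left
      (((𝒲.W a).modelEquiv hB R (𝒲.isAffineOpen a)).symm (t.s a))
    have hb := OpenOver.res_modelHom hB R (V := 𝒲.W b) (W := 𝒲.W₂ a b) inf_le_right
      (((𝒲.W b).modelEquiv hB R (𝒲.isAffineOpen b)).symm (t.s b))
    rw [ea] at ha
    rw [eb] at hb
    rw [map_mul, ten, ten, ← ha, ← hb, ← trans_eq_modelHom]
    exact t.cocycle a b

/-- The coordinates of `ofCechTriv`. [folklore] -/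
@[simp] theorem ModelTriv.ofCechTriv_s (t : 𝒲.toChartedCover.CechTriv (𝒲.strMap R hB))
    (a : 𝒲.κ) :
    (ModelTriv.ofCechTriv t).s a =
      ((𝒲.W a).modelEquiv hB R (𝒲.isAffineOpen a)).symm (t.s a) := rfl

/-- `ofCechTriv ∘ toCechTriv = id`. [folklore] -/
theorem ModelTriv.ofCechTriv_toCechTriv (t : 𝒲.ModelTriv R) :
    ModelTriv.ofCechTriv (t.toCechTriv (hB := hB)) = t := by
  ext a
  exact ((𝒲.W a).modelEquiv hB R (𝒲.isAffineOpen a)).symm_apply_apply _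

/-- `toCechTriv ∘ ofCechTriv = id`. [folklore] -/
theorem ModelTriv.toCechTriv_ofCechTriv (t : 𝒲.toChartedCover.CechTriv (𝒲.strMap R hB)) :
    (ModelTriv.ofCechTriv t).toCechTriv = t := by
  ext a
  exact ((𝒲.W a).modelEquiv hB R (𝒲.isAffineOpen a)).apply_symm_apply _

/-- **Restriction to a smaller neighbourhood is the change of level**: the Čech trivialisation
restricted along the transition map `P × Spec R' → P × Spec R` corresponds to `(id ⊗ ψ)(s_a)`
(`OpenOver.transitionMap_modelHom`). [folklore] -/
theorem ModelTriv.ofCechTriv_restrict_transition {R' : Type u} [CommRing R']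
    [Algebra Γ(T.left, B) R'] (ψ : R →ₐ[Γ(T.left, B)] R')
    (t : 𝒲.toChartedCover.CechTriv (𝒲.strMap R hB)) :
    ModelTriv.ofCechTriv (t.restrict (P ◁ OpenOver.modelTransition hB ψ).left
        (𝒲.transition_comp_strMap ψ)) =
      (ModelTriv.ofCechTriv t).mapLevel ψ := by
  ext a
  rw [ofCechTriv_s, mapLevel_s, ofCechTriv_s, AlgEquiv.symm_apply_eq, OpenOver.modelEquiv_apply,
    ← OpenOver.transitionMap_modelHom]
  have e1 : (𝒲.W a).modelHom hB R (((𝒲.W a).modelEquiv hB R (𝒲.isAffineOpen a)).symm (t.s a)) =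
      t.s a :=
    ((𝒲.W a).modelEquiv hB R (𝒲.isAffineOpen a)).apply_symm_apply (t.s a)
  rw [e1, CartierDivisor.ChartedCover.CechTriv.restrict_s]
  rfl

/-- **Restriction along the slice is slicing in the model**: the Čech trivialisation restricted
along `q × Spec R : P' × Spec R → P × Spec R` corresponds to `((q × T)^* ⊗ id)(s_a)`
(`OpenOver.sliceMap_modelHom`). [folklore] -/
theorem ModelTriv.ofCechTriv_restrict_slice {P' : SchemeOver K} (q : P' ⟶ P)
    [IsAffineHom (q ▷ T).left] [IsSeparated P'.hom]
    (t : 𝒲.toChartedCover.CechTriv (𝒲.strMap R hB)) :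
    ModelTriv.ofCechTriv (𝒲 := 𝒲.slice q)
        ((t.restrict (q ▷ modelPt T hB R).left (𝒲.slice_comp_strMap q) :
          (𝒲.slice q).toChartedCover.CechTriv ((𝒲.slice q).strMap R hB))) =
      (ModelTriv.ofCechTriv t).mapSlice q := by
  ext a
  rw [ofCechTriv_s, mapSlice_s, ofCechTriv_s, AlgEquiv.symm_apply_eq, OpenOver.modelEquiv_apply]
  have e1 : (𝒲.W a).modelHom hB R (((𝒲.W a).modelEquiv hB R (𝒲.isAffineOpen a)).symm (t.s a)) =
      t.s a :=
    ((𝒲.W a).modelEquiv hB R (𝒲.isAffineOpen a)).apply_symm_apply (t.s a)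
  have e2 := OpenOver.sliceMap_modelHom hB R q (𝒲.W a)
    (((𝒲.W a).modelEquiv hB R (𝒲.isAffineOpen a)).symm (t.s a))
  rw [e1] at e2
  refine Eq.trans ?_ e2
  rw [CartierDivisor.ChartedCover.CechTriv.restrict_s]
  rfl

end Dictionary

end TowerCover

end Literature.AlgebraicGeometry.Motives

end
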